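import Summits.QuantumFields.YangMills.Theorems.BalabanLadderNTSubsequentialNontrivial
import Summits.QuantumFields.YangMills.Theorems.LangevinControlUVOSLegsFromFemtoAndGapDefsR3
import HarnessLib

/-!
# Crux `NT` (stmt-QuantumFields-19353) / leg `UV`: the joint soft legs along a scheme in a prescribed cofinal coupling set,
# with the UV collar data, the IR family AND NT's floors all read ON THAT SET ONLY

Helper file (`--supports stmt-QuantumFields-19353`) of the fleet lead prover of crux `NT` (unit `ym-spine-19353-p1`, g29),
hypothesis-free.  HONEST FRAMING: nothing here is asserted about Yang–Mills; every binder is a HYPOTHESIS about lattice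
Yang–Mills (Wilson's measure on odd tori, unit map `a`); `NT`, a floor, the gap, `YangMills` are NOT proved by any of this.

WHAT.  `softLegs_joint_growth_onSet`: as `softLegs_joint_growth_subseq` (`Theorems/BalabanLadderNTSubsequentialGrowth.lean`) with
ONE further change — the UV input is no longer the global `MomentBounds6 G r a` but the a-uniform PLANE-STRING BOUNDS (the output
of the tree's `exists_planeString_bounds`, toolkit XIV) AT THE COUPLINGS OF `Bset` ONLY, taken as a hypothesis (they follow from
`MomentBounds6` restricted to `Bset`, next file `…NTSubsequentialBridgeOn`).  For the record, the description of the template: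
the tree's `softLegs_joint_growth` (`Theorems/LangevinControlUVOSLegsFromFemtoAndGapStubGrowth.lean`,
toolkit XV with a coupling threshold `b₀` and a growth demand `g`; the IR desk's cofinal-couplings variant
`softLegs_joint_growth_onCouplings`, `Theorems/BalabanLadderIRCofinalCouplingsGrowth.lean`, is the template) re-run with the
non-triviality leg WEAKENED to what the proof actually uses and nothing else changed:
* the `LowerBounds G r a` hypothesis (floor (i) `ε ≤ Q2 (θv) v` and floor (ii) `ε' ≤ |Q3 f g h|` at EVERY coupling `β ≥ β₅` on
  EVERY torus `2L+1` with `Λ₅ ≤ a β · L`) is replaced by: ONE real positive-time `v`, `ε > 0`, THREE pairwise-disjointly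
  supported `f, g, h`, `ε' > 0` such that AT EVERY COUPLING OF THE SET `Bset` BOTH floors hold ON TORI OF UNBOUNDED SIZE
  (`∀ β ∈ Bset, ∀ D, ∃ L ≥ D, ε ≤ Q2 G r β L (a β) (θv) v ∧ ε' ≤ |Q3 G r β L (a β) f g h|`) — no volume threshold, no
  «all large tori», no coupling outside `Bset`;
* the gap family is `GapInUnits` RESTRICTED to `Bset` (as in the IR desk's file), `Bset` cofinal (`∀ x, ∃ β ∈ Bset, x ≤ β`);
* the scheme: base couplings `βs k ∈ Bset` above `B + k`, and the torus `Ls k` is CHOSEN among NT's good tori above the running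
  demand `max (14, S₁ (βs k), ⌈a⁻²⌉, max_{i ≤ k} g (βs k) i)` — so both floors hold at EVERY step of the scheme, and toolkit
  XI-b is invoked in its sequence form (`twoPointNontrivial_of_eventually_q2Floor`, `nonGaussian_of_eventually_q3Floor`,
  `Theorems/BalabanLadderNTSubsequentialNontrivial.lean`).
Steps 3–9 and 11–13 are byte-identical with the template.  Export: `SoftBundle G r a sch S₁ Tq K b₀ g ∧ ∀ k, sch.β k ∈ Bset`.

WHY.  With this variant ALL FOUR legs are read at the couplings of ONE cofinal set (UV through `Hbd`, IR through the restricted family, NT through its floors; ROT is scheme-level anyway).  The deciding bridge `Y2Bridge.yangMills_of_legs` touches `NT` ONLY here;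
hence the summit needs NT's two floors only at the couplings of a cofinal set and, at each of them, only on infinitely many
tori (`Theorems/BalabanLadderNTSubsequentialBridge.lean` draws the consequence `yangMills_of_subseqNTLegs`).  The typed leaf
(`∀ β ≥ β₅`, `∀ L ≥ Λ₅ / a β`) over-asks on both axes by exactly the «all couplings» / «all large volumes» clauses that
∃-type arguments (octave sum rules, pigeonholes over test functions, special torus sizes) cannot deliver. [folklore]
-/

set_option autoImplicit false

noncomputable section

open scoped SchwartzMap BigOperators
open MeasureTheory Filter Topology
open Literature.MathematicalPhysics.QuantumFieldTheory Literature.MathematicalPhysics.QuantumLattice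
open Literature.MathematicalPhysics.AQFT
open Literature.Probability.LatticeModels (box Site)
open Summit.QuantumFields.YangMills.Cruxes.OSLegsFromFemtoAndGap.DlrCollarTransfer
  (Q2 Q3 MomentBounds6 LowerBounds GapInUnits SoftBundle)

namespace Summit.QuantumFields.YangMills.Theorems.OSLegsFromFemtoAndGap

variable {G : Type} [Group G] [TopologicalSpace G] [IsTopologicalGroup G] [CompactSpace G]
  [MeasurableSpace G] [BorelSpace G]

/-- **Joint soft legs along a scheme in a cofinal set `Bset`, every leg read on `Bset` only.**  From `(∀ β, 0 < a β)`, `a → 0`,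
the a-uniform plane-string bounds AT THE COUPLINGS OF `Bset` (constants `β₄, ℓ₄, K`), the
SUBSEQUENTIAL non-triviality data (one positive-time `v`, `ε > 0`, pairwise-disjointly supported `f, g, h`, `ε' > 0`, and at
every `β ∈ Bset` both floors `ε ≤ Q2 G r β L (a β) (θv) v`, `ε' ≤ |Q3 G r β L (a β) f g h|` on tori `L` of unbounded size),
the `GapInUnits` family restricted to `Bset`, and cofinality of `Bset`: for every threshold `b₀` and every demand
`g : ℝ → ℕ → ℕ` a scheme `sch` in units `a`, a one-field family `S₁`, plane-string limits `Tq` and an a-uniform constant `K`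
with `SoftBundle G r a sch S₁ Tq K b₀ g` and `sch.β k ∈ Bset` for every `k`. [folklore] -/
theorem softLegs_joint_growth_onSet (r : LatticeRep G) {a : ℝ → ℝ} (hapos : ∀ β, 0 < a β)
    (hlim : Tendsto a atTop (𝓝 0)) (Bset : Set ℝ) (hBcof : ∀ x : ℝ, ∃ β ∈ Bset, x ≤ β)
    {β₄ ℓ₄ K : ℝ} (hℓ : 0 < ℓ₄) (hK : 0 ≤ K)
    (Hbd : ∀ β ∈ Bset, β₄ ≤ β → 0 < a β → a β ≤ 1 / 24 → a β ≤ ℓ₄ →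
      ∀ L : ℕ, 14 ≤ L → (a β)⁻¹ * (a β)⁻¹ ≤ L →
      ∀ n : ℕ, 2 ≤ n → ∀ q : Fin n → Fin 4 × Fin 4, (∀ i, (q i).1 < (q i).2) →
      ∀ F : 𝓢((Fin n → EuclideanSpace ℝ (Fin 4)), ℂ), IsOffDiagonal F →
      (∀ y : (Fin n → Site 4) → (Fin n → EuclideanSpace ℝ (Fin 4)), (∀ x l, ‖y x l - a β • siteToE (x l)‖ ≤ 6 * a β) →
        ‖∑ x ∈ Fintype.piFinset (fun _ : Fin n => box 4 L),
            ((torusMomentStr r.ρ β L (fun i U => plaquetteObs r.ρ 0 (q i).1 (q i).2 U)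
              (fun i => wilsonTorusMean r.ρ β L (fun U => plaquetteObs r.ρ 0 (q i).1 (q i).2 U)) x : ℝ) : ℂ) *
            F (y x)‖ ≤
          K ^ n * (SchwartzMap.seminorm ℂ 0 (4 * n) F + SchwartzMap.seminorm ℂ (6 * n) (4 * n) F +
            SchwartzMap.seminorm ℂ 0 0 F + SchwartzMap.seminorm ℂ (6 * n) 0 F + SchwartzMap.seminorm ℂ (10 * n) 0 F)) ∧
      (∀ c : Fin n → EuclideanSpace ℝ (Fin 4), (∀ l, ‖c l‖ ≤ a β) →
        ‖∑ x ∈ Fintype.piFinset (fun _ : Fin n => box 4 L),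
            ((torusMomentStr r.ρ β L (fun i U => plaquetteObs r.ρ 0 (q i).1 (q i).2 U)
              (fun i => wilsonTorusMean r.ρ β L (fun U => plaquetteObs r.ρ 0 (q i).1 (q i).2 U)) x : ℝ) : ℂ) *
            (F ((fun l => a β • siteToE (x l)) + c) - F (fun l => a β • siteToE (x l)))‖ ≤
          2 * ‖c‖ * K ^ n * (SchwartzMap.seminorm ℂ 0 (4 * n + 1) F + SchwartzMap.seminorm ℂ (6 * n) (4 * n + 1) F +
            SchwartzMap.seminorm ℂ 0 1 F + SchwartzMap.seminorm ℂ (6 * n) 1 F + SchwartzMap.seminorm ℂ (10 * n) 1 F)))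
    (hNT : ∃ (v : 𝓢(EuclideanSpace ℝ (Fin 4), ℝ)) (ε : ℝ) (f g h : 𝓢(EuclideanSpace ℝ (Fin 4), ℝ)) (ε' : ℝ),
      tsupport (v : EuclideanSpace ℝ (Fin 4) → ℝ) ⊆ {y : EuclideanSpace ℝ (Fin 4) | 0 < y 0} ∧ 0 < ε ∧
      Disjoint (tsupport f) (tsupport g) ∧ Disjoint (tsupport g) (tsupport h) ∧ Disjoint (tsupport f) (tsupport h) ∧
      0 < ε' ∧ ∀ β ∈ Bset, ∀ D : ℕ, ∃ L : ℕ, D ≤ L ∧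
        ε ≤ Q2 G r β L (a β) (thetaTest 4 v) v ∧ ε' ≤ |Q3 G r β L (a β) f g h|)
    (hgap : ∃ (c₁ β₂ : ℝ) (S₁ : ℝ → ℕ), 0 < c₁ ∧ ∀ A B : YMSpecies G, ∃ C : ℝ, ∀ β ∈ Bset, β₂ ≤ β →
      ∀ S n : ℕ, S₁ β ≤ S → n ≤ S →
        |latticeConnectedCorr r.ρ β (2 * S + 1) A.F B.F n| ≤ C * Real.exp (-(c₁ * a β * n)))
    (b₀ : ℝ) (g : ℝ → ℕ → ℕ) :
    ∃ (sch : SpeciesScheme (YMSpecies G)) (S₁ : SchwingerFamily (EuclideanSpace ℝ (Fin 4)))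
      (Tq : (n : ℕ) → (Fin n → Fin 4 × Fin 4) → (𝓢((Fin n → EuclideanSpace ℝ (Fin 4)), ℂ) →L[ℂ] ℂ)) (K : ℝ),
      SoftBundle G r a sch S₁ Tq K b₀ g ∧ ∀ k, sch.β k ∈ Bset := by
  classical
  unfold SoftBundle
  /- 1. CONSTANTS: the a-uniform bound for plane strings is the HYPOTHESIS `Hbd` (on `Bset`); the gap data, the
    subsequential lower-bound data -/
  obtain ⟨c₁, β₂, S₁g, hc₁, Hgap⟩ := hgap
  obtain ⟨v, ε₂, f₃, g₃, h₃, ε₃, hv, hε₂, hfg, hgh, hfh, hε₃, HNT⟩ := hNT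
  -- `a β ≤ min (1/24) ℓ₄` for `β ≥ B₁`
  obtain ⟨B₁, hB₁⟩ : ∃ B₁ : ℝ, ∀ β, B₁ ≤ β → a β < min (1 / 24) ℓ₄ :=
    Filter.eventually_atTop.1 (hlim.eventually (gt_mem_nhds (by positivity)))
  /- 2. THE SEQUENCES: couplings IN `Bset` above every threshold (including `b₀`), spacings, and tori CHOSEN BY NT above
    the running demand (`14`, the gap's volume threshold, `a⁻²`, the running maximum of the demand `g`) -/
  obtain ⟨B, hBdef⟩ : ∃ B : ℝ, B = max (max β₄ β₂) (max B₁ (max 0 b₀)) := ⟨_, rfl⟩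
  have hchoice : ∀ k : ℕ, ∃ β ∈ Bset, B + (k : ℝ) ≤ β := fun k => hBcof _
  choose βs hβsmem hβsge using hchoice
  have hβsB : ∀ k, B ≤ βs k := fun k =>
    le_trans (le_add_of_nonneg_right (Nat.cast_nonneg k)) (hβsge k)
  have hβs4 : ∀ k, β₄ ≤ βs k := fun k => le_trans (by rw [hBdef]; simp) (hβsB k)
  have hβs2 : ∀ k, β₂ ≤ βs k := fun k => le_trans (by rw [hBdef]; simp) (hβsB k)
  have hβs1 : ∀ k, B₁ ≤ βs k := fun k => le_trans (by rw [hBdef]; simp) (hβsB k)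
  have hβs0 : ∀ k, 0 ≤ βs k := fun k => le_trans (by rw [hBdef]; simp) (hβsB k)
  have hβsb : ∀ k, b₀ ≤ βs k := fun k => le_trans (by rw [hBdef]; simp) (hβsB k)
  have hβs_top : Tendsto βs atTop atTop :=
    tendsto_atTop_mono hβsge (tendsto_atTop_add_const_left atTop B tendsto_natCast_atTop_atTop)
  have ha_pos : ∀ k, 0 < a (βs k) := fun k => hapos _
  have ha_24 : ∀ k, a (βs k) ≤ 1 / 24 := fun k => (hB₁ _ (hβs1 k)).le.trans (min_le_left _ _)
  have ha_1 : ∀ k, a (βs k) ≤ 1 := fun k => (ha_24 k).trans (by norm_num)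
  have ha_ℓ : ∀ k, a (βs k) ≤ ℓ₄ := fun k => (hB₁ _ (hβs1 k)).le.trans (min_le_right _ _)
  have ha_top : Tendsto (fun k => a (βs k)) atTop (𝓝 0) := hlim.comp hβs_top
  -- the running demand, and NT's choice of a good torus above it (THE CHANGE against the template)
  obtain ⟨Dm, hDm⟩ : ∃ Dm : ℕ → ℕ, Dm = fun k =>
      max (max (max 14 (S₁g (βs k))) ⌈(a (βs k))⁻¹ * (a (βs k))⁻¹⌉₊)
        ((Finset.range (k + 1)).sup (g (βs k))) := ⟨_, rfl⟩
  have hgood : ∀ k : ℕ, ∃ L : ℕ, Dm k ≤ L ∧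
      ε₂ ≤ Q2 G r (βs k) L (a (βs k)) (thetaTest 4 v) v ∧ ε₃ ≤ |Q3 G r (βs k) L (a (βs k)) f₃ g₃ h₃| :=
    fun k => HNT (βs k) (hβsmem k) (Dm k)
  choose Ls hLsD hLsQ2 hLsQ3 using hgood
  have hL14 : ∀ k, 14 ≤ Ls k := fun k => by
    refine le_trans ?_ (hLsD k)
    rw [hDm]; exact le_trans (le_trans (le_max_left _ _) (le_max_left _ _)) (le_max_left _ _)
  have hLS : ∀ k, S₁g (βs k) ≤ Ls k := fun k => by
    refine le_trans ?_ (hLsD k)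
    rw [hDm]; exact le_trans (le_trans (le_max_right _ _) (le_max_left _ _)) (le_max_left _ _)
  have hLa : ∀ k, (a (βs k))⁻¹ * (a (βs k))⁻¹ ≤ Ls k := fun k => by
    have h1 : ((⌈(a (βs k))⁻¹ * (a (βs k))⁻¹⌉₊ : ℕ) : ℝ) ≤ Ls k := by
      have h2 : ⌈(a (βs k))⁻¹ * (a (βs k))⁻¹⌉₊ ≤ Ls k := by
        refine le_trans ?_ (hLsD k)
        rw [hDm]; exact le_trans (le_max_right _ _) (le_max_left _ _)
      exact_mod_cast h2
    exact (Nat.le_ceil _).trans h1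
  have hLg : ∀ k, (Finset.range (k + 1)).sup (g (βs k)) ≤ Ls k := fun k => by
    refine le_trans ?_ (hLsD k)
    rw [hDm]; exact le_max_right _ _
  have haL_top : Tendsto (fun k => a (βs k) * Ls k) atTop atTop := by
    -- `a L ≥ a · a⁻² = a⁻¹ → ∞`
    have h1 : Tendsto (fun k => (a (βs k))⁻¹) atTop atTop :=
      tendsto_inv_nhdsGT_zero.comp (tendsto_nhdsWithin_iff.2 ⟨ha_top, Eventually.of_forall fun k => ha_pos k⟩)
    refine tendsto_atTop_mono (fun k => ?_) h1
    have := mul_le_mul_of_nonneg_left (hLa k) (ha_pos k).le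
    rwa [← mul_assoc, mul_inv_cancel₀ (ha_pos k).ne', one_mul] at this

  /- 3. THE JOINT SUBSEQUENCE AND THE LIMITS of all plane-string distributions on `⁰𝒮ₙ`, `n ≥ 2` -/
  -- shorthand for the string observables / weights / distributions at step `k`
  have Hstr : ∀ (k n : ℕ), 2 ≤ n → ∀ q : Fin n → Fin 4 × Fin 4, (∀ i, (q i).1 < (q i).2) →
      ∀ F : 𝓢((Fin n → EuclideanSpace ℝ (Fin 4)), ℂ), IsOffDiagonal F →
      ∀ y : (Fin n → Site 4) → (Fin n → EuclideanSpace ℝ (Fin 4)), (∀ x l, ‖y x l - a (βs k) • siteToE (x l)‖ ≤ 6 * a (βs k)) →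
        ‖∑ x ∈ Fintype.piFinset (fun _ : Fin n => box 4 (Ls k)),
            ((torusMomentStr r.ρ (βs k) (Ls k) (fun i U => plaquetteObs r.ρ 0 (q i).1 (q i).2 U)
              (fun i => wilsonTorusMean r.ρ (βs k) (Ls k) (fun U => plaquetteObs r.ρ 0 (q i).1 (q i).2 U)) x : ℝ) : ℂ) *
            F (y x)‖ ≤
          K ^ n * (SchwartzMap.seminorm ℂ 0 (4 * n) F + SchwartzMap.seminorm ℂ (6 * n) (4 * n) F +
            SchwartzMap.seminorm ℂ 0 0 F + SchwartzMap.seminorm ℂ (6 * n) 0 F +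
            SchwartzMap.seminorm ℂ (10 * n) 0 F) :=
    fun k n hn q hq F hF y hy =>
      (Hbd (βs k) (hβsmem k) (hβs4 k) (ha_pos k) (ha_24 k) (ha_ℓ k) (Ls k) (hL14 k) (hLa k) n hn q hq F hF).1 y hy
  have Hdef : ∀ (k n : ℕ), 2 ≤ n → ∀ q : Fin n → Fin 4 × Fin 4, (∀ i, (q i).1 < (q i).2) →
      ∀ F : 𝓢((Fin n → EuclideanSpace ℝ (Fin 4)), ℂ), IsOffDiagonal F → ∀ c : Fin n → EuclideanSpace ℝ (Fin 4), (∀ l, ‖c l‖ ≤ a (βs k)) →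
        ‖∑ x ∈ Fintype.piFinset (fun _ : Fin n => box 4 (Ls k)),
            ((torusMomentStr r.ρ (βs k) (Ls k) (fun i U => plaquetteObs r.ρ 0 (q i).1 (q i).2 U)
              (fun i => wilsonTorusMean r.ρ (βs k) (Ls k) (fun U => plaquetteObs r.ρ 0 (q i).1 (q i).2 U)) x : ℝ) : ℂ) *
            (F ((fun l => a (βs k) • siteToE (x l)) + c) - F (fun l => a (βs k) • siteToE (x l)))‖ ≤
          2 * ‖c‖ * K ^ n * (SchwartzMap.seminorm ℂ 0 (4 * n + 1) F + SchwartzMap.seminorm ℂ (6 * n) (4 * n + 1) F +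
            SchwartzMap.seminorm ℂ 0 1 F + SchwartzMap.seminorm ℂ (6 * n) 1 F + SchwartzMap.seminorm ℂ (10 * n) 1 F) :=
    fun k n hn q hq F hF c hc =>
      (Hbd (βs k) (hβsmem k) (hβs4 k) (ha_pos k) (ha_24 k) (ha_ℓ k) (Ls k) (hL14 k) (hLa k) n hn q hq F hF).2 c hc
  have hlatStr : ∀ (k n : ℕ), 2 ≤ n → ∀ q : Fin n → Fin 4 × Fin 4, (∀ i, (q i).1 < (q i).2) →
      ∀ F : 𝓢((Fin n → EuclideanSpace ℝ (Fin 4)), ℂ), IsOffDiagonal F →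
        ‖latticeDistStr r.ρ (βs k) (Ls k) (a (βs k)) (fun i U => plaquetteObs r.ρ 0 (q i).1 (q i).2 U)
          (fun i => wilsonTorusMean r.ρ (βs k) (Ls k) (fun U => plaquetteObs r.ρ 0 (q i).1 (q i).2 U)) F‖ ≤
          5 * K ^ n * schwartzNorm (10 * n) F := by
    intro k n hn q hq F hF
    rw [latticeDistStr_apply]
    calc _ ≤ K ^ n * (SchwartzMap.seminorm ℂ 0 (4 * n) F + SchwartzMap.seminorm ℂ (6 * n) (4 * n) F +
          SchwartzMap.seminorm ℂ 0 0 F + SchwartzMap.seminorm ℂ (6 * n) 0 F +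
          SchwartzMap.seminorm ℂ (10 * n) 0 F) :=
          Hstr k n hn q hq F hF (fun x l => a (βs k) • siteToE (x l)) (fun x l => by
            rw [sub_self, norm_zero]; exact mul_nonneg (by norm_num) (ha_pos k).le)
      _ ≤ K ^ n * (5 * schwartzNorm (10 * n) F) := by
          gcongr; exact seminorm_budget_le_schwartzNorm n F
      _ = _ := by ring
  -- the joint index: arity and plane string (invalid strings carry the zero distribution)
  obtain ⟨T, hT⟩ : ∃ T : (i : Σ n : ℕ, (Fin n → Fin 4 × Fin 4)) → ℕ → (𝓢((Fin i.1 → EuclideanSpace ℝ (Fin 4)), ℂ) →L[ℂ] ℂ),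
      T = fun i k => if 2 ≤ i.1 ∧ (∀ l, (i.2 l).1 < (i.2 l).2) then
        latticeDistStr r.ρ (βs k) (Ls k) (a (βs k)) (fun l U => plaquetteObs r.ρ 0 (i.2 l).1 (i.2 l).2 U)
          (fun l => wilsonTorusMean r.ρ (βs k) (Ls k) (fun U => plaquetteObs r.ρ 0 (i.2 l).1 (i.2 l).2 U))
        else 0 := ⟨_, rfl⟩
  let Mod : (i : Σ n : ℕ, (Fin n → Fin 4 × Fin 4)) → Submodule ℂ 𝓢((Fin i.1 → EuclideanSpace ℝ (Fin 4)), ℂ) := fun i =>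
    { carrier := {F | IsOffDiagonal F}
      add_mem' := fun hF hG => hF.add hG
      zero_mem' := isOffDiagonal_zero
      smul_mem' := fun c _ hF => hF.smul c }
  have hMod : ∀ i (F : 𝓢((Fin i.1 → EuclideanSpace ℝ (Fin 4)), ℂ)), F ∈ Mod i ↔ IsOffDiagonal F := fun i F => Iff.rfl
  have hbound : ∀ i k, ∀ F ∈ Mod i, ‖T i k F‖ ≤ 5 * K ^ i.1 * schwartzNorm (10 * i.1) F := by
    rintro ⟨n, q⟩ k F hF
    rw [hMod] at hF
    by_cases hn : 2 ≤ n ∧ (∀ l, (q l).1 < (q l).2)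
    · rw [hT]; dsimp only; rw [if_pos hn]; exact hlatStr k n hn.1 q hn.2 F hF
    · rw [hT]; dsimp only; rw [if_neg hn]; simp only [zero_apply, norm_zero]
      exact mul_nonneg (by positivity) (schwartzNorm_nonneg _ _)
  obtain ⟨φ, hφ, Slim, hSlim, hconvS⟩ := exists_subseq_clm_limit
    (X := fun i : (Σ n : ℕ, (Fin n → Fin 4 × Fin 4)) => Fin i.1 → EuclideanSpace ℝ (Fin 4)) T Mod
    (fun i => 10 * i.1) (fun i => 5 * K ^ i.1) (fun i => by positivity) hbound
  -- the limits of the valid plane strings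
  obtain ⟨Tq, hTq⟩ : ∃ Tq : (n : ℕ) → (Fin n → Fin 4 × Fin 4) → (𝓢((Fin n → EuclideanSpace ℝ (Fin 4)), ℂ) →L[ℂ] ℂ),
      Tq = fun n q => Slim ⟨n, q⟩ := ⟨_, rfl⟩
  have hconvStr : ∀ n, 2 ≤ n → ∀ q : Fin n → Fin 4 × Fin 4, (∀ i, (q i).1 < (q i).2) →
      ∀ F : 𝓢((Fin n → EuclideanSpace ℝ (Fin 4)), ℂ), IsOffDiagonal F →
        Tendsto (fun j => latticeDistStr r.ρ (βs (φ j)) (Ls (φ j)) (a (βs (φ j)))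
          (fun i U => plaquetteObs r.ρ 0 (q i).1 (q i).2 U)
          (fun i => wilsonTorusMean r.ρ (βs (φ j)) (Ls (φ j)) (fun U => plaquetteObs r.ρ 0 (q i).1 (q i).2 U)) F)
          atTop (𝓝 (Tq n q F)) := by
    intro n hn q hq F hF
    have h := hconvS ⟨n, q⟩ F ((hMod ⟨n, q⟩ F).2 hF)
    rw [hT] at h; dsimp only at h; simp only [if_pos (And.intro hn hq)] at h
    rw [hTq]; exact h
  have hTqbd : ∀ (n : ℕ) (q : Fin n → Fin 4 × Fin 4) (F : 𝓢((Fin n → EuclideanSpace ℝ (Fin 4)), ℂ)),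
      ‖Tq n q F‖ ≤ 5 * K ^ n * schwartzNorm (10 * n) F := fun n q F => by
    rw [hTq]; exact hSlim ⟨n, q⟩ F
  -- the one-field limit: the sum over the valid strings
  obtain ⟨S, hSdef⟩ : ∃ S : (n : ℕ) → (𝓢((Fin n → EuclideanSpace ℝ (Fin 4)), ℂ) →L[ℂ] ℂ), S = fun n =>
      ∑ q ∈ Fintype.piFinset (fun _ : Fin n => Finset.univ.filter fun p : Fin 4 × Fin 4 => p.1 < p.2), Tq n q :=
    ⟨_, rfl⟩
  have hS_apply : ∀ n (F : 𝓢((Fin n → EuclideanSpace ℝ (Fin 4)), ℂ)), S n F =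
      ∑ q ∈ Fintype.piFinset (fun _ : Fin n => Finset.univ.filter fun p : Fin 4 × Fin 4 => p.1 < p.2), Tq n q F := by
    intro n F; rw [hSdef]; simp only [FunLike.coe_sum, Finset.sum_apply]
  have hconv2 : ∀ n, 2 ≤ n → ∀ F : 𝓢((Fin n → EuclideanSpace ℝ (Fin 4)), ℂ), IsOffDiagonal F →
      Tendsto (fun j => latticeDist r.ρ (βs (φ j)) (Ls (φ j)) (a (βs (φ j))) r.curvature.F
        (wilsonTorusMean r.ρ (βs (φ j)) (Ls (φ j)) r.curvature.F) n F) atTop (𝓝 (S n F)) := by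
    intro n hn F hF
    rw [hS_apply]
    simp_rw [latticeDist_dens_eq_sum_latticeDistStr]
    refine tendsto_finsetSum _ fun q hq => hconvStr n hn q ((mem_planeStrings_iff q).1 hq) F hF
  have hcardP : ∀ n, ((Fintype.piFinset (fun _ : Fin n => Finset.univ.filter fun p : Fin 4 × Fin 4 => p.1 < p.2)).card : ℝ)
      = 6 ^ n := fun n => by
    rw [Fintype.card_piFinset, Finset.prod_const, Finset.card_univ, Fintype.card_fin, card_planes]; push_cast; ring
  have hS : ∀ n (F : 𝓢((Fin n → EuclideanSpace ℝ (Fin 4)), ℂ)), ‖S n F‖ ≤ 5 * (6 * K) ^ n * schwartzNorm (10 * n) F := by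
    intro n F
    rw [hS_apply]
    calc _ ≤ ∑ q ∈ Fintype.piFinset (fun _ : Fin n => Finset.univ.filter fun p : Fin 4 × Fin 4 => p.1 < p.2),
          ‖Tq n q F‖ := norm_sum_le _ _
      _ ≤ ∑ _q ∈ Fintype.piFinset (fun _ : Fin n => Finset.univ.filter fun p : Fin 4 × Fin 4 => p.1 < p.2),
          5 * K ^ n * schwartzNorm (10 * n) F := Finset.sum_le_sum fun q _ => hTqbd n q F
      _ = 6 ^ n * (5 * K ^ n * schwartzNorm (10 * n) F) := by rw [Finset.sum_const, nsmul_eq_mul, hcardP]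
      _ = 5 * (6 * K) ^ n * schwartzNorm (10 * n) F := by rw [mul_pow]; ring
  /- 4. THE ONE-FIELD FAMILY: evaluation / zero / the limit -/
  obtain ⟨S₁, hS₁⟩ : ∃ S₁ : SchwingerFamily (EuclideanSpace ℝ (Fin 4)), S₁ = fun n =>
      if n = 0 then LabelledSchwingerFamily.evalAt (default : Fin n → EuclideanSpace ℝ (Fin 4)) else if n = 1 then 0 else S n :=
    ⟨_, rfl⟩
  have hS₁0 : ∀ F : 𝓢((Fin 0 → EuclideanSpace ℝ (Fin 4)), ℂ), S₁ 0 F = F default := fun F => by rw [hS₁]; simp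
  have hS₁1 : ∀ F : 𝓢((Fin 1 → EuclideanSpace ℝ (Fin 4)), ℂ), S₁ 1 F = 0 := fun F => by rw [hS₁]; simp
  have hS₁2 : ∀ n, 2 ≤ n → S₁ n = S n := fun n hn => by
    rw [hS₁]; dsimp only; rw [if_neg (by omega), if_neg (by omega)]
  /- 5. THE SCHEME along the subsequence -/
  let sch : SpeciesScheme (YMSpecies G) :=
    { a := fun j => a (βs (φ j))
      a_pos := fun j => ha_pos _
      tendsto_a := ha_top.comp hφ.tendsto_atTop
      β := fun j => βs (φ j)
      L := fun j => Ls (φ j)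
      tendsto_L := haL_top.comp hφ.tendsto_atTop
      c := fun _ j => ((a (βs (φ j)))⁻¹) ^ 4
      m := fun s j => wilsonTorusMean r.ρ (βs (φ j)) (Ls (φ j)) s.F }
  /- 6. CONVERGENCE of every arity along `sch` -/
  have hconv_all : ∀ (n : ℕ) (F : 𝓢((Fin n → EuclideanSpace ℝ (Fin 4)), ℂ)), IsOffDiagonal F →
      Tendsto (fun j => latticeDist r.ρ (βs (φ j)) (Ls (φ j)) (a (βs (φ j))) r.curvature.F
        (wilsonTorusMean r.ρ (βs (φ j)) (Ls (φ j)) r.curvature.F) n F) atTop (𝓝 (S₁ n F)) := by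
    intro n F hF
    rcases Nat.lt_or_ge n 2 with hn | hn
    · interval_cases n
      · simp_rw [latticeDist_zero_apply r.ρ r.continuous, hS₁0]; exact tendsto_const_nhds
      · simp_rw [latticeDist_one_apply, hS₁1]; exact tendsto_const_nhds
    · rw [hS₁2 n hn]; exact hconv2 n hn F hF
  /- 7. E0, E3, E1-translations by inheritance (toolkit VIII-b) -/
  obtain ⟨C₀, hC₀⟩ := r.curvature.bounded
  have hC₀0 : 0 ≤ C₀ := le_trans (abs_nonneg _) (hC₀ (fun _ => 1))
  have hW : ∀ (n j : ℕ) (x : Fin n → Site 4), |torusMoment r.ρ (βs (φ j)) (Ls (φ j)) r.curvature.F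
      (wilsonTorusMean r.ρ (βs (φ j)) (Ls (φ j)) r.curvature.F) x| ≤ (C₀ + C₀) ^ n := by
    intro n j x
    refine (abs_torusMoment_le_pow r _ _ r.curvature hC₀ _ x).trans ?_
    exact pow_le_pow_left₀ (by positivity)
      (by linarith [abs_wilsonTorusMean_le r (βs (φ j)) (Ls (φ j)) r.curvature hC₀]) n
  have hlatAll : ∀ n, ∀ᶠ j in atTop, ∀ F : 𝓢((Fin n → EuclideanSpace ℝ (Fin 4)), ℂ), IsOffDiagonal F →
      ‖latticeDist r.ρ (βs (φ j)) (Ls (φ j)) (a (βs (φ j))) r.curvature.F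
        (wilsonTorusMean r.ρ (βs (φ j)) (Ls (φ j)) r.curvature.F) n F‖ ≤ 5 * (6 * K) ^ n * schwartzNorm (10 * n) F := by
    intro n
    refine Eventually.of_forall fun j F hF => ?_
    rcases Nat.lt_or_ge n 2 with hn | hn
    · interval_cases n
      · rw [latticeDist_zero_apply r.ρ r.continuous]
        have h1 := norm_le_schwartzNorm 0 F default
        have h0 := schwartzNorm_nonneg 0 F
        simp only [pow_zero, mul_one, mul_zero]
        linarith
      · rw [latticeDist_one_apply, norm_zero]; exact mul_nonneg (by positivity) (schwartzNorm_nonneg _ _)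
    · rw [latticeDist_dens_eq_sum_latticeDistStr]
      calc _ ≤ ∑ q ∈ Fintype.piFinset (fun _ : Fin n => Finset.univ.filter fun p : Fin 4 × Fin 4 => p.1 < p.2),
            ‖latticeDistStr r.ρ (βs (φ j)) (Ls (φ j)) (a (βs (φ j))) (fun i U => plaquetteObs r.ρ 0 (q i).1 (q i).2 U)
              (fun i => wilsonTorusMean r.ρ (βs (φ j)) (Ls (φ j)) (fun U => plaquetteObs r.ρ 0 (q i).1 (q i).2 U)) F‖ :=
            norm_sum_le _ _
        _ ≤ ∑ _q ∈ Fintype.piFinset (fun _ : Fin n => Finset.univ.filter fun p : Fin 4 × Fin 4 => p.1 < p.2),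
            5 * K ^ n * schwartzNorm (10 * n) F :=
            Finset.sum_le_sum fun q hq => hlatStr (φ j) n hn q ((mem_planeStrings_iff q).1 hq) F hF
        _ = 6 ^ n * (5 * K ^ n * schwartzNorm (10 * n) F) := by rw [Finset.sum_const, nsmul_eq_mul, hcardP]
        _ = 5 * (6 * K) ^ n * schwartzNorm (10 * n) F := by rw [mul_pow]; ring
  obtain ⟨hE0, hE3, htrans⟩ := limit_isNormalized_isSymmetric_translate r.ρ r.continuous
    (fun j => βs (φ j)) (fun j => Ls (φ j)) (fun j => a (βs (φ j))) r.curvature.F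
    (fun j => wilsonTorusMean r.ρ (βs (φ j)) (Ls (φ j)) r.curvature.F) S₁ hconv_all
    (fun n => 5 * (6 * K) ^ n) (fun n => 10 * n) hlatAll (by positivity : (0 : ℝ) ≤ C₀ + C₀) hW
    (fun j => ha_pos _) (fun j => ha_1 _) (fun j => hLa _) (ha_top.comp hφ.tendsto_atTop)
  /- 8. E0′ -/
  have hbdS₁ : ∀ (n : ℕ) (F : 𝓢((Fin n → EuclideanSpace ℝ (Fin 4)), ℂ)), ‖S₁ n F‖ ≤ 5 * (6 * K) ^ n * schwartzNorm (10 * n) F := by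
    intro n F
    rcases Nat.lt_or_ge n 2 with hn | hn
    · interval_cases n
      · rw [hS₁0]
        have h1 := norm_le_schwartzNorm 0 F default
        have h0 := schwartzNorm_nonneg 0 F
        simp only [pow_zero, mul_one, mul_zero]
        linarith
      · rw [hS₁1, norm_zero]; exact mul_nonneg (by positivity) (schwartzNorm_nonneg _ _)
    · rw [hS₁2 n hn]; exact hS n F
  have hE0' : S₁.toLabelled.HasLinearGrowth := by
    intro _
    have h6K : 0 ≤ 6 * K := by positivity
    refine ⟨10, 5 * Real.exp (6 * K), 1, fun n k _ F _ => ?_⟩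
    simp only [SchwingerFamily.toLabelled_apply, Real.rpow_one]
    calc ‖S₁ n F‖ ≤ 5 * (6 * K) ^ n * schwartzNorm (10 * n) F := hbdS₁ n F
      _ ≤ 5 * (Real.exp (6 * K) * (n.factorial : ℝ)) * schwartzNorm (10 * n) F := by
          gcongr
          · exact schwartzNorm_nonneg _ _
          · exact pow_le_exp_mul_factorial h6K n
      _ = 5 * Real.exp (6 * K) * (n.factorial : ℝ) * schwartzNorm (n * 10) F := by rw [mul_comm n 10]; ring
  /- 9. THE ONE-FIELD CONVERGENCE CLAUSE along `sch` (`c a⁴ = 1`) -/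
  have hYM : ∀ n : ℕ, n ≠ 0 → ∀ (f : Fin n → 𝓢(EuclideanSpace ℝ (Fin 4), ℝ)) (F : 𝓢((Fin n → EuclideanSpace ℝ (Fin 4)), ℂ)),
      IsTensorOf F (fun i => ofRealTest (f i)) → IsOffDiagonal F →
        Tendsto (fun k : ℕ => ((latticeSchwinger r.ρ sch (fun s => s.F) k n (fun _ => r.curvature) f : ℝ) : ℂ))
          atTop (𝓝 (S₁ n F)) := by
    intro n _ f F hF hod
    have hkey : ∀ k, ((latticeSchwinger r.ρ sch (fun s => s.F) k n (fun _ => r.curvature) f : ℝ) : ℂ) =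
        latticeDist r.ρ (βs (φ k)) (Ls (φ k)) (a (βs (φ k))) r.curvature.F
          (wilsonTorusMean r.ρ (βs (φ k)) (Ls (φ k)) r.curvature.F) n F := by
      intro k
      rw [latticeSchwinger_eq_latticeDist r sch r.curvature k n f F hF]
      have hc : sch.c r.curvature k * (sch.a k) ^ 4 = 1 := by
        show ((a (βs (φ k)))⁻¹) ^ 4 * (a (βs (φ k))) ^ 4 = 1
        rw [← mul_pow, inv_mul_cancel₀ (ha_pos _).ne', one_pow]
      rw [hc, one_pow, Complex.ofReal_one, one_mul]
    simp_rw [hkey]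
    exact hconv_all n F hod
  /- 10. NON-TRIVIALITY, NON-GAUSSIANITY (toolkit XI-b in sequence form: both floors hold at EVERY step of the scheme) -/
  have hβφ : Tendsto (fun j => βs (φ j)) atTop atTop := hβs_top.comp hφ.tendsto_atTop
  have hNT := twoPointNontrivial_of_eventually_q2Floor r (a := a) hv hε₂ (fun j => βs (φ j)) (fun j => Ls (φ j))
    (Eventually.of_forall fun j => hLsQ2 (φ j)) S₁ hS₁1 (hconv_all 2)
  have hNG := nonGaussian_of_eventually_q3Floor r (a := a) hfg hgh hfh hε₃ (fun j => βs (φ j)) (fun j => Ls (φ j))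
    (Eventually.of_forall fun j => hLsQ3 (φ j)) S₁ hS₁1 (hconv_all 3)

  /- 11. THE LATTICE GAP in units `a` along `sch` -/
  have hLG : HasLatticeMassGap r sch c₁ := by
    intro A B'
    obtain ⟨C, hC⟩ := Hgap A B'
    refine ⟨C, Eventually.of_forall fun k S hS n hn => ?_⟩
    have h := hC (βs (φ k)) (hβsmem _) (hβs2 _) S n ((hLS _).trans hS) hn
    show |latticeConnectedCorr r.ρ (βs (φ k)) (2 * S + 1) A.F B'.F n| ≤
      C * Real.exp (-(c₁ * (a (βs (φ k)) * n)))
    rwa [← mul_assoc]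
  /- 12. THE TWO SCHEME DEMANDS along `sch`: `b₀ ≤ β_{φ k}` and `g (β_{φ k}) k ≤ max_{i ≤ φ k} g (β_{φ k}) i ≤ L_{φ k}`
    (`k ≤ φ k` since `φ` is strictly monotone) -/
  have hdem : ∀ k, b₀ ≤ βs (φ k) ∧ g (βs (φ k)) k ≤ Ls (φ k) := fun k =>
    ⟨hβsb (φ k),
      (Finset.le_sup (f := g (βs (φ k))) (Finset.mem_range.2 (Nat.lt_succ_of_le hφ.le_apply))).trans (hLg (φ k))⟩
  /- 13. ASSEMBLE -/
  refine ⟨sch, S₁, Tq, K, ⟨⟨fun k => rfl, fun s k => rfl, fun s k => rfl, hβφ, hE0, hE0', hE3, htrans, hS₁0, hS₁1,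
    fun n _ F hF => hconv_all n F hF, ⟨hK, hbdS₁⟩, hYM, hNT, hNG, ⟨c₁, hc₁, hLG⟩,
    fun k => ⟨hβs0 _, ha_24 _, hL14 _, hLa _⟩, fun k n hn q hq F hF y hy => Hstr (φ k) n hn q hq F hF y hy,
    fun k n hn q hq F hF c hc => Hdef (φ k) n hn q hq F hF c hc,
    fun n hn q hq F hF => hconvStr n hn q hq F hF, fun n hn F => ?_⟩, fun k => hdem k⟩, fun k => hβsmem (φ k)⟩
  rw [hS₁2 n hn, hS_apply]

end Summit.QuantumFields.YangMills.Theorems.OSLegsFromFemtoAndGap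

end
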